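import Summits.QuantumFields.BalabanUV.Beta.GAN24.BornLambdaDrift
import Summits.QuantumFields.BalabanUV.Beta.GAN24.BornLambdaSectorRowHolds
import Summits.QuantumFields.BalabanUV.Beta.GAN24.StencilSlotSupRate

/-!
# `BalabanUV.Beta.GAN24.BornLambdaDriftSup` — binder row G-an2-4 ∕ (CONV-C), CT-ROUTE (R8°), THE RATE HALF OF THE Λ-BORN ROW, PART 2:
# **`hBdev(0,cΛ)` FROM TOP-ALIGNED PAIR LETTERS IN SUP-NORM CURRENCY** — road S3's currency for its DIFF rows (`S3DiffL.diffL_three`: `SupBound`, no decay asked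
# of the differences) — by the interpolation of road S3's `StencilSlotSupRate.locStencilCauchy_of_uniform_supRate` against the tree's UNIFORM letter hB(0,cΛ)
# (leaf-04 g56's `BornLambdaSectorRowHolds.exists_hBLam_three`)

NOT IN PRINT; OUR BOOKKEEPING (G-an2-4 formalisation swarm → CRUX TEAM (2), leaf prover `b2b-balaban-gan24-formalise-leaf-06`, gen 41; PART 1 =
`GAN24/BornLambdaDrift`).  HONEST FRAMING (cell contract, verbatim): «discharging `BetaPertH` makes Bałaban's UV stability UNCONDITIONAL — a real
constructive-QFT result; it is NOT the continuum limit and NOT the Clay problem.»  HONEST DEPENDENCY (verbatim): «continuum YM on T⁴ ⇐ BetaPertH ∧ nine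
spine estimates (0/9 proved); BetaPertH ⇐ (D1) ∧ (D4) ∧ CAP+tail; G-an2-4 gates asym, D1 and NE2/3/4.»  [folklore] bookkeeping BY NAME over PART 1's schema at
locality rate `0` (`LocStencil S C 0` IS the entrywise sup bound), road S3's `locStencilCauchy_of_uniform_supRate` (uniform locality + one-step sup rate ⇒ the
weighted Cauchy shape, rate `√θ`, decay `δ∕2`), leaf-04 g56's (C6) `exists_hBLam_three` (hB(0,cΛ) UNCONDITIONAL) and PART 1's `exists_hXd_lam_three` ∕
`exists_hT_lam_three`; 0 `def`, 0 cited facts, 0 `def … : Prop`, 0 sorry; NO estimate of Bałaban's; the END is a SOCKET (its one hypothesis, the sup-norm pair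
letters, is OPEN); discharges NOTHING of (hS, hSall) on (E); NEVER «G-an2-4 closed» as (CONV-C); NOT D1, NOT `BetaPertH`, NOT continuum, NOT Clay.

## Why a second currency
PART 1 asks the pair letters in `LocStencil` currency (decay AND rate).  Road S3 proved the rate half of the one-shot family the other way: a `j`-uniform
`LocStencil` letter (hS) and a one-step rate in SUP norm only, interpolated (`|x| ≤ min(ε, C e^{−δr}) ≤ √(εC) e^{−δr∕2}`).  For the Λ-born row the uniform letter
hB(0,cΛ) is in the tree since 19:43Z (p301679), so the pair letters may be supplied WITHOUT decay: `SupBound ((ℓ(i+1,k+1) − ℓ(i,k)) κ′ u′) (CP·(k−i)^q·Θ^k)` —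
EXACTLY the currency of road S3's `diffL_three` ∕ `diffLt_three` (`eL·θ^{n+1}·ρ^{n−m}`), whose rooted twins would be the undressed instance.

## Contents
§1 (generic `d`) `locStencil_zero_iff_supBound`, `supBound_of_locStencil` (decay forgotten); §2 (generic `d`, in-block root) **`exists_hBdevLam_of_supLetters`**:
uniform letter `hB` + fresh sup-drift + top sup-letter + sup pair letters ⇒ hBdev(0,cΛ) (rate `√θ`, decay `δ∕2`); §3 (`d = 3`, `2 ≤ Lc`, pin `cE = Lc^4`) END
**`exists_hBdevLam_three_of_supPairs`**: `hBdev(0,cΛ) ⟸ THE SUP-NORM PAIR LETTERS ALONE` (hB, the fresh drift and the top lineage are TREE ∕ PART 1).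
Unit `b2b-balaban-gan24-formalise-leaf-06` (gen 41), 2026-08-21.
-/

noncomputable section

open Finset
open scoped BigOperators
open Literature.MathematicalPhysics.QuantumFieldTheory
open Literature.MathematicalPhysics.QuantumFieldTheory.Balaban1983to89
open Literature.MathematicalPhysics.QuantumFieldTheory.Balaban1983to89.Beta
open ExpKernelCalculus (MKer)
open OneStepResolventKernel (Fib LocStencil)
open AffineAveraging (box toSite)
open B12Sec2to5 (l1 l1_nonneg)
open BalabanCompositeJets (respStep)
open Summit.QuantumFields.BalabanUV.Beta.HessKerDressedUnits (unitS)
open Summit.QuantumFields.BalabanUV.Beta.GAN24.CombesThomas (sfStep smStep SupBound)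
open Summit.QuantumFields.BalabanUV.Beta.GAN24.StencilSlotOfShapes (locStencil_mono')
open Summit.QuantumFields.BalabanUV.Beta.GAN24.StencilSlotSupRate (locStencilCauchy_of_uniform_supRate)
open Summit.QuantumFields.BalabanUV.Beta.GAN24.Push3 (push₃)
open Summit.QuantumFields.BalabanUV.Beta.GAN24.Push4Iter (legChain)
open Summit.QuantumFields.BalabanUV.Beta.GAN24.RespStepBmDecompExact (respStepBmSeq)
open Summit.QuantumFields.BalabanUV.Beta.GAN24.SrecWilsonSector (bornSecAt)
open Summit.QuantumFields.BalabanUV.Beta.GAN24.SrecBornSector (freshAt)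
open Summit.QuantumFields.BalabanUV.Beta.GAN24.BornLambdaLineage (unitS_bornLam_eq_sum_push₃)
open Summit.QuantumFields.BalabanUV.Beta.GAN24.BornLambdaDrift (exists_consec_of_pairLetters exists_hXd_lam_three exists_hT_lam_three)
open Summit.QuantumFields.BalabanUV.Beta.GAN24.BornLambdaSectorRowHolds (exists_hBLam_three)
open Summit.QuantumFields.BalabanUV.Beta.GAN24.BornLambdaRowHolds (exists_hUg_three)
open Summit.QuantumFields.BalabanUV.Beta.GAN24.BornLambdaContactBound (exists_hCg_three)
open Summit.QuantumFields.BalabanUV.Beta.GAN24.StencilSlotCauchyOfShapes (locStencil_sub)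
open StepJetData (locStencil_add)

namespace Summit.QuantumFields.BalabanUV.Beta.GAN24.BornLambdaDriftSup

variable {d : ℕ}

/-! ## §1 Locality rate `0` is the entrywise sup bound -/

/-- [folklore] **`LocStencil S C 0` IS THE ENTRYWISE SUP BOUND** `∀ κ u, SupBound (S κ u) C` (`e^{−0·r} = 1`). -/
theorem locStencil_zero_iff_supBound {S : Fin (d + 1) → (Fin (d + 1) → ℤ) → MKer (d + 1) (Fib d)} {C : ℝ} :
    LocStencil S C 0 ↔ ∀ κ u, SupBound (S κ u) C := by
  constructor
  · intro h κ u x y a b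
    have h1 := h κ u x y a b
    rwa [neg_zero, zero_mul, Real.exp_zero, mul_one] at h1
  · intro h κ u x y a b
    rw [neg_zero, zero_mul, Real.exp_zero, mul_one]
    exact h κ u x y a b

/-- [folklore] **DECAY FORGOTTEN**: a local stencil family at a rate `δ ≥ 0` is entrywise bounded by its constant (`LocStencil S C δ → LocStencil S C 0`). -/
theorem locStencil_zero_of_locStencil {S : Fin (d + 1) → (Fin (d + 1) → ℤ) → MKer (d + 1) (Fib d)} {C δ : ℝ} (h : LocStencil S C δ) (hδ : 0 ≤ δ) :
    LocStencil S C 0 :=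
  locStencil_mono' h le_rfl hδ

/-! ## §2 The Λ-born instance in sup currency (generic `d`, in-block root) -/

section Letters

variable {Lc : ℕ} [NeZero Lc]

/-- NOT IN PRINT; OUR BOOKKEEPING (generic `d`, in-block root; a SOCKET).  **THE RATE HALF OF THE Λ-BORN ROW FROM A UNIFORM LETTER AND THREE SUP-NORM LETTERS**:
the `k`-uniform local-stencil letter `hB` of the unit tables `U_k` of `bornSecAt Lc ρ cE 0 cΛ` (one `CB, δB > 0` for all roots and levels), a fresh-source SUP drift
`CF·θF^k`, a top-lineage SUP letter `CT·(k+1)^p·θT^{k+1}` and top-aligned pair SUP letters `CP·(k−i)^q·Θ^k` (entrywise, NO decay asked) give the all-scales Cauchy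
letter `LocStencil (U_{k+j} − U_k) (cB·θB^k) (δB∕2)` — PART 1's schema at locality rate `0` for the one-step sup rate, then road S3's interpolation
`locStencilCauchy_of_uniform_supRate` (`θB = √θ`). -/
theorem exists_hBdevLam_of_supLetters (cE cΛ : ℝ) {p q : ℕ}
    (hB : ∃ CB δB : ℝ, 0 < δB ∧ ∀ (rr : Fin (d + 1) → ℕ), rr ∈ box (d + 1) Lc →
      ∀ k : ℕ, LocStencil (unitS (sfStep Lc k) (smStep d Lc k) (bornSecAt Lc (toSite rr) cE 0 cΛ k)) CB δB)
    (hXd : ∃ CF θF : ℝ, 0 ≤ CF ∧ 0 ≤ θF ∧ θF < 1 ∧ ∀ (rr : Fin (d + 1) → ℕ), rr ∈ box (d + 1) Lc → ∀ (k : ℕ) κ u,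
      SupBound ((unitS (sfStep Lc (k + 1)) (smStep d Lc (k + 1)) (freshAt Lc (toSite rr) 0 cΛ (k + 1))
        - unitS (sfStep Lc k) (smStep d Lc k) (freshAt Lc (toSite rr) 0 cΛ k)) κ u) (CF * θF ^ k))
    (hT : ∃ CT θT : ℝ, 0 ≤ CT ∧ 0 ≤ θT ∧ θT < 1 ∧ ∀ (rr : Fin (d + 1) → ℕ), rr ∈ box (d + 1) Lc → ∀ (k : ℕ) κ u,
      SupBound ((fun κ' u' => (cE * (Lc : ℝ) ^ (2 * (d + 1))) ^ (k + 1) •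
        push₃ (legChain (respStepBmSeq (toSite rr) Lc) 0 k) (legChain (respStepBmSeq (toSite rr) Lc) 0 k) (legChain (respStepBmSeq (toSite rr) Lc) 0 k)
          (unitS (sfStep Lc 0) (smStep d Lc 0) (freshAt Lc (toSite rr) 0 cΛ 0)) κ' u') κ u) (CT * ((((k + 1 : ℕ) : ℝ)) ^ p * θT ^ (k + 1))))
    (hP : ∃ CP Θ : ℝ, 0 ≤ CP ∧ 0 ≤ Θ ∧ Θ < 1 ∧ ∀ (rr : Fin (d + 1) → ℕ), rr ∈ box (d + 1) Lc → ∀ k i : ℕ, i < k → ∀ κ u,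
      SupBound
        (((fun κ' u' => (cE * (Lc : ℝ) ^ (2 * (d + 1))) ^ (k - i) •
            push₃ (legChain (respStepBmSeq (toSite rr) Lc) (i + 1) (k - 1 - i)) (legChain (respStepBmSeq (toSite rr) Lc) (i + 1) (k - 1 - i))
              (legChain (respStepBmSeq (toSite rr) Lc) (i + 1) (k - 1 - i))
              (unitS (sfStep Lc (i + 1)) (smStep d Lc (i + 1)) (freshAt Lc (toSite rr) 0 cΛ (i + 1))) κ' u')
          - fun κ' u' => (cE * (Lc : ℝ) ^ (2 * (d + 1))) ^ (k - i) •
            push₃ (legChain (respStepBmSeq (toSite rr) Lc) i (k - 1 - i)) (legChain (respStepBmSeq (toSite rr) Lc) i (k - 1 - i))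
              (legChain (respStepBmSeq (toSite rr) Lc) i (k - 1 - i))
              (unitS (sfStep Lc i) (smStep d Lc i) (freshAt Lc (toSite rr) 0 cΛ i)) κ' u') κ u)
        (CP * ((((k - i : ℕ) : ℝ)) ^ q * Θ ^ k))) :
    ∃ cB θB δB : ℝ, 0 ≤ cB ∧ 0 ≤ θB ∧ θB < 1 ∧ 0 < δB ∧ ∀ (rr : Fin (d + 1) → ℕ), rr ∈ box (d + 1) Lc → ∀ k j : ℕ,
      LocStencil (unitS (sfStep Lc (k + j)) (smStep d Lc (k + j)) (bornSecAt Lc (toSite rr) cE 0 cΛ (k + j))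
        - unitS (sfStep Lc k) (smStep d Lc k) (bornSecAt Lc (toSite rr) cE 0 cΛ k)) (cB * θB ^ k) δB := by
  obtain ⟨CB, δB, hδB, hB⟩ := hB
  obtain ⟨CF, θF, hCF, hθF0, hθF1, hXd⟩ := hXd
  obtain ⟨CT, θT, hCT, hθT0, hθT1, hT⟩ := hT
  obtain ⟨CP, Θ, hCP, hΘ0, hΘ1, hP⟩ := hP
  -- PART 1's schema at locality rate 0 = the one-step SUP rate of `U`
  obtain ⟨c, θ, hc, hθ0, hθ1, hschema⟩ :=
    exists_consec_of_pairLetters (d := d) (δ := 0) (p := p) (q := q) hCF hθF0 hθF1 hCT hθT0 hθT1 hCP hΘ0 hΘ1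
  have hroot : (fun _ : Fin (d + 1) => (0 : ℕ)) ∈ box (d + 1) Lc :=
    AveragingMixedJetTables.zero_mem_box (Nat.one_le_iff_ne_zero.2 (NeZero.ne Lc))
  have hCB : 0 ≤ CB := ((hB _ hroot 0) 0 0).nonneg (Sum.inl 0)
  have h1θ : 0 < 1 - θ := by linarith
  refine ⟨Real.sqrt (2 * (c / (1 - θ)) * CB), Real.sqrt θ, δB / 2, Real.sqrt_nonneg _, Real.sqrt_nonneg _,
    (Real.sqrt_lt' one_pos).2 (by rwa [one_pow]), by positivity, fun rr hrr k j => ?_⟩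
  -- the one-step sup rate at this root
  have hrate : ∀ (n : ℕ) κ u, SupBound (unitS (sfStep Lc (n + 1)) (smStep d Lc (n + 1)) (bornSecAt Lc (toSite rr) cE 0 cΛ (n + 1)) κ u
      - unitS (sfStep Lc n) (smStep d Lc n) (bornSecAt Lc (toSite rr) cE 0 cΛ n) κ u) (c * θ ^ n) := by
    intro n
    have h0 : LocStencil (unitS (sfStep Lc (n + 1)) (smStep d Lc (n + 1)) (bornSecAt Lc (toSite rr) cE 0 cΛ (n + 1))
        - unitS (sfStep Lc n) (smStep d Lc n) (bornSecAt Lc (toSite rr) cE 0 cΛ n)) (c * θ ^ n) 0 := by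
      rw [unitS_bornLam_eq_sum_push₃ hrr cE cΛ (n + 1), unitS_bornLam_eq_sum_push₃ hrr cE cΛ n]
      refine hschema (fun k => unitS (sfStep Lc k) (smStep d Lc k) (freshAt Lc (toSite rr) 0 cΛ k))
        (fun i k => fun κ' u' => (cE * (Lc : ℝ) ^ (2 * (d + 1))) ^ (k - i) •
          push₃ (legChain (respStepBmSeq (toSite rr) Lc) i (k - 1 - i)) (legChain (respStepBmSeq (toSite rr) Lc) i (k - 1 - i))
            (legChain (respStepBmSeq (toSite rr) Lc) i (k - 1 - i))
            (unitS (sfStep Lc i) (smStep d Lc i) (freshAt Lc (toSite rr) 0 cΛ i)) κ' u')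
        (fun k => locStencil_zero_iff_supBound.2 (hXd rr hrr k)) (fun k => ?_) (fun k i hik => ?_) n
      · have h := locStencil_zero_iff_supBound.2 (hT rr hrr k)
        simp only [Nat.sub_zero, Nat.add_sub_cancel]
        exact h
      · have h := locStencil_zero_iff_supBound.2 (hP rr hrr k i hik)
        have e2 : k - (i + 1) = k - 1 - i := by omega
        simp only [Nat.add_sub_add_right, Nat.add_sub_cancel, e2]
        exact h
    intro κ u
    exact (locStencil_zero_iff_supBound.1 h0) κ u
  exact locStencilCauchy_of_uniform_supRate (F := fun n => unitS (sfStep Lc n) (smStep d Lc n) (bornSecAt Lc (toSite rr) cE 0 cΛ n))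
    (fun n => hB rr hrr n) hrate hc hθ0.le hθ1 k j

end Letters

/-! ## §3 `d = 3`: the END socket in sup currency -/

section Three

variable {Lc : ℕ} [NeZero Lc]

/-- NOT IN PRINT; OUR PROOF ATTEMPT — A SOCKET (`d = 3`, `2 ≤ Lc`, pin `cE = Lc^4`; [folklore] assembly).  **`hBdev(0,cΛ)` OF THE `d = 3` COMB FAMILY FROM THE
TOP-ALIGNED PAIR LETTERS IN SUP-NORM CURRENCY ALONE**: if for every in-block root, every `i < k` and every entry the lineage of member `k+1` born at `i+1` minus the
lineage of member `k` born at `i` is bounded by `CP·(k−i)^q·Θ^k` (`Θ < 1`; NO decay asked), then the unit tables of `bornSecAt Lc ρ cE 0 cΛ` obey the all-scales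
Cauchy letter with ONE `cB`, ONE `θB < 1`, ONE `δB > 0` — hB(0,cΛ) by leaf-04 g56's `exists_hBLam_three`, the fresh drift and the top lineage by PART 1 (decay
forgotten).  The pair letter is NOT proved here; NOT hSdev of the comb family; NEVER «G-an2-4 closed». -/
theorem exists_hBdevLam_three_of_supPairs (hLc : 2 ≤ Lc) {cE : ℝ} (hcE : cE = (Lc : ℝ) ^ (3 + 1)) (cΛ : ℝ) (q : ℕ)
    (hP : ∃ CP Θ : ℝ, 0 ≤ CP ∧ 0 ≤ Θ ∧ Θ < 1 ∧ ∀ (rr : Fin (3 + 1) → ℕ), rr ∈ box (3 + 1) Lc → ∀ k i : ℕ, i < k → ∀ κ u,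
      SupBound
        (((fun κ' u' => (cE * (Lc : ℝ) ^ (2 * (3 + 1))) ^ (k - i) •
            push₃ (legChain (respStepBmSeq (toSite rr) Lc) (i + 1) (k - 1 - i)) (legChain (respStepBmSeq (toSite rr) Lc) (i + 1) (k - 1 - i))
              (legChain (respStepBmSeq (toSite rr) Lc) (i + 1) (k - 1 - i))
              (unitS (sfStep Lc (i + 1)) (smStep 3 Lc (i + 1)) (freshAt Lc (toSite rr) 0 cΛ (i + 1))) κ' u')
          - fun κ' u' => (cE * (Lc : ℝ) ^ (2 * (3 + 1))) ^ (k - i) •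
            push₃ (legChain (respStepBmSeq (toSite rr) Lc) i (k - 1 - i)) (legChain (respStepBmSeq (toSite rr) Lc) i (k - 1 - i))
              (legChain (respStepBmSeq (toSite rr) Lc) i (k - 1 - i))
              (unitS (sfStep Lc i) (smStep 3 Lc i) (freshAt Lc (toSite rr) 0 cΛ i)) κ' u') κ u)
        (CP * ((((k - i : ℕ) : ℝ)) ^ q * Θ ^ k))) :
    ∃ cB θB δB : ℝ, 0 ≤ cB ∧ 0 ≤ θB ∧ θB < 1 ∧ 0 < δB ∧ ∀ (rr : Fin (3 + 1) → ℕ), rr ∈ box (3 + 1) Lc → ∀ k j : ℕ,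
      LocStencil (unitS (sfStep Lc (k + j)) (smStep 3 Lc (k + j)) (bornSecAt Lc (toSite rr) cE 0 cΛ (k + j))
        - unitS (sfStep Lc k) (smStep 3 Lc k) (bornSecAt Lc (toSite rr) cE 0 cΛ k)) (cB * θB ^ k) δB := by
  obtain ⟨CF, θF, δF, hCF, hθF0, hθF1, hδF, hXd⟩ := exists_hXd_lam_three hLc cΛ
  obtain ⟨CT, θT, δT, hCT, hθT0, hθT1, hδT, hT⟩ := exists_hT_lam_three hLc hcE cΛ
  refine exists_hBdevLam_of_supLetters (d := 3) (p := 1) cE cΛ (exists_hBLam_three hLc hcE cΛ)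
    ⟨CF, θF, hCF, hθF0, hθF1, fun rr hrr k => locStencil_zero_iff_supBound.1 (locStencil_zero_of_locStencil (hXd rr hrr k) hδF.le)⟩
    ⟨CT, θT, hCT, hθT0, hθT1, fun rr hrr k => locStencil_zero_iff_supBound.1 (locStencil_zero_of_locStencil (hT rr hrr k) hδT.le)⟩ hP

/-! ## §4 `d = 3`: the pair `i = 0` is free (both members by the lineage letters) -/

/-- NOT IN PRINT; OUR BOOKKEEPING (`d = 3`, `2 ≤ Lc`, pin `cE = Lc^4`, UNCONDITIONAL).  **THE TOP-ALIGNED PAIR AT BIRTH LEVEL `0` NEEDS NO CAUCHY INPUT**: member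
`k+1`'s lineage born at `1` and member `k`'s born at `0` (`k ≥ 1`) are EACH bounded by the lineage letters (the owner's `exists_hUg_three` + leaf-02 g49's
`exists_hCg_three`, lengths `k`), so their difference is a local stencil family with constant `C·k·Θ^k` — the `i = 0` instance of PART 1's `hP` VERBATIM
(`q = 1`; indices left raw: `k - 0`, `0 + 1`, `k - 1 - 0`).  The pairs `i ≥ 1` (road S3's rooted DIFF rows for the undressed part + the differenced contact
cells) remain OPEN. -/
theorem exists_pairZero_lam_three (hLc : 2 ≤ Lc) {cE : ℝ} (hcE : cE = (Lc : ℝ) ^ (3 + 1)) (cΛ : ℝ) :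
    ∃ CP Θ δP : ℝ, 0 ≤ CP ∧ 0 ≤ Θ ∧ Θ < 1 ∧ 0 < δP ∧ ∀ (rr : Fin (3 + 1) → ℕ), rr ∈ box (3 + 1) Lc → ∀ k : ℕ, 0 < k →
      LocStencil
        ((fun κ' u' => (cE * (Lc : ℝ) ^ (2 * (3 + 1))) ^ (k - 0) •
            push₃ (legChain (respStepBmSeq (toSite rr) Lc) (0 + 1) (k - 1 - 0)) (legChain (respStepBmSeq (toSite rr) Lc) (0 + 1) (k - 1 - 0))
              (legChain (respStepBmSeq (toSite rr) Lc) (0 + 1) (k - 1 - 0))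
              (unitS (sfStep Lc (0 + 1)) (smStep 3 Lc (0 + 1)) (freshAt Lc (toSite rr) 0 cΛ (0 + 1))) κ' u')
          - fun κ' u' => (cE * (Lc : ℝ) ^ (2 * (3 + 1))) ^ (k - 0) •
            push₃ (legChain (respStepBmSeq (toSite rr) Lc) 0 (k - 1 - 0)) (legChain (respStepBmSeq (toSite rr) Lc) 0 (k - 1 - 0))
              (legChain (respStepBmSeq (toSite rr) Lc) 0 (k - 1 - 0))
              (unitS (sfStep Lc 0) (smStep 3 Lc 0) (freshAt Lc (toSite rr) 0 cΛ 0)) κ' u')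
        (CP * ((((k - 0 : ℕ) : ℝ)) ^ 1 * Θ ^ k)) δP := by
  obtain ⟨C₁, θ₁, δ₁, hC₁, hθ₁0, hθ₁1, hδ₁, hU⟩ := exists_hUg_three hLc hcE cΛ
  have hcE' : |cE| ≤ (Lc : ℝ) ^ 4 := by rw [hcE, abs_of_nonneg (by positivity)]
  obtain ⟨C₂, θ₂, δ₂, hC₂, hθ₂0, hθ₂1, hδ₂, hCg⟩ := exists_hCg_three hLc cE cΛ hcE'
  set Θ : ℝ := max θ₁ θ₂ with hΘ
  have hΘ0 : 0 ≤ Θ := le_max_of_le_left hθ₁0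
  have hΘ1 : Θ < 1 := max_lt hθ₁1 hθ₂1
  refine ⟨C₁ + C₂ + (C₁ + C₂), Θ, min δ₁ δ₂, by positivity, hΘ0, hΘ1, lt_min hδ₁ hδ₂, fun rr hrr k hk => ?_⟩
  -- a lineage = undressed + contact, as `LocStencil` families with the two letters added
  have hmem : ∀ i n : ℕ, i < n → LocStencil (fun κ' u' => (cE * (Lc : ℝ) ^ (2 * (3 + 1))) ^ (n - i) •
      push₃ (legChain (respStepBmSeq (toSite rr) Lc) i (n - 1 - i)) (legChain (respStepBmSeq (toSite rr) Lc) i (n - 1 - i))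
        (legChain (respStepBmSeq (toSite rr) Lc) i (n - 1 - i)) (unitS (sfStep Lc i) (smStep 3 Lc i) (freshAt Lc (toSite rr) 0 cΛ i)) κ' u')
      (C₁ * θ₁ ^ (n - i) + C₂ * ((((n - i : ℕ) : ℝ)) ^ 1 * θ₂ ^ (n - i))) (min δ₁ δ₂) := by
    intro i n hin
    have h1 := locStencil_mono' (hU rr hrr n i hin) le_rfl (min_le_left δ₁ δ₂)
    have h2 := locStencil_mono' (hCg rr hrr n i hin) le_rfl (min_le_right δ₁ δ₂)
    have h := locStencil_add h1 h2
    refine locStencil_mono' (S := fun κ' u' => (cE * (Lc : ℝ) ^ (2 * (3 + 1))) ^ (n - i) •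
      push₃ (legChain (respStepBmSeq (toSite rr) Lc) i (n - 1 - i)) (legChain (respStepBmSeq (toSite rr) Lc) i (n - 1 - i))
        (legChain (respStepBmSeq (toSite rr) Lc) i (n - 1 - i)) (unitS (sfStep Lc i) (smStep 3 Lc i) (freshAt Lc (toSite rr) 0 cΛ i)) κ' u') ?_ le_rfl le_rfl
    have e : (fun κ' u' => (cE * (Lc : ℝ) ^ (2 * (3 + 1))) ^ (n - i) •
        push₃ (legChain (respStepBmSeq (toSite rr) Lc) i (n - 1 - i)) (legChain (respStepBmSeq (toSite rr) Lc) i (n - 1 - i))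
          (legChain (respStepBmSeq (toSite rr) Lc) i (n - 1 - i)) (unitS (sfStep Lc i) (smStep 3 Lc i) (freshAt Lc (toSite rr) 0 cΛ i)) κ' u')
        = fun κ' u => (fun κ' u' => (cE * (Lc : ℝ) ^ (2 * (3 + 1))) ^ (n - i) •
            push₃ (respStep (d := 3) (Lc ^ i) (Lc ^ n)) (respStep (d := 3) (Lc ^ i) (Lc ^ n)) (respStep (d := 3) (Lc ^ i) (Lc ^ n))
              (unitS (sfStep Lc i) (smStep 3 Lc i) (freshAt Lc (toSite rr) 0 cΛ i)) κ' u') κ' u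
          + (fun κ' u' => (cE * (Lc : ℝ) ^ (2 * (3 + 1))) ^ (n - i) •
            (push₃ (legChain (respStepBmSeq (toSite rr) Lc) i (n - 1 - i)) (legChain (respStepBmSeq (toSite rr) Lc) i (n - 1 - i))
                (legChain (respStepBmSeq (toSite rr) Lc) i (n - 1 - i)) (unitS (sfStep Lc i) (smStep 3 Lc i) (freshAt Lc (toSite rr) 0 cΛ i)) κ' u'
              - push₃ (respStep (d := 3) (Lc ^ i) (Lc ^ n)) (respStep (d := 3) (Lc ^ i) (Lc ^ n)) (respStep (d := 3) (Lc ^ i) (Lc ^ n))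
                (unitS (sfStep Lc i) (smStep 3 Lc i) (freshAt Lc (toSite rr) 0 cΛ i)) κ' u')) κ' u := by
      funext κ' u'
      simp only [smul_sub, add_sub_cancel]
    rw [e]
    exact h
  have ha := hmem 1 (k + 1) (by omega)
  have hb := hmem 0 k hk
  simp only [Nat.add_sub_cancel, Nat.sub_zero] at ha hb
  simp only [Nat.sub_zero, Nat.zero_add]
  have hab := locStencil_sub ha hb
  refine locStencil_mono' hab ?_ le_rfl
  -- `(C₁ θ₁^k + C₂ k θ₂^k) + (C₁ θ₁^k + C₂ k θ₂^k) ≤ (C₁ + C₂ + (C₁ + C₂))·k·Θ^k` for `k ≥ 1`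
  have hk1 : (1 : ℝ) ≤ (k : ℝ) := by exact_mod_cast hk
  have hp1 : θ₁ ^ k ≤ Θ ^ k := pow_le_pow_left₀ hθ₁0 (le_max_left _ _) _
  have hp2 : θ₂ ^ k ≤ Θ ^ k := pow_le_pow_left₀ hθ₂0 (le_max_right _ _) _
  have hTk : 0 ≤ Θ ^ k := pow_nonneg hΘ0 _
  rw [pow_one]
  nlinarith [mul_nonneg hC₁ hTk, mul_nonneg hC₂ hTk, mul_le_mul_of_nonneg_left hp1 hC₁, mul_le_mul_of_nonneg_left hp2 hC₂,
    mul_nonneg (mul_nonneg hC₁ hTk) (sub_nonneg.2 hk1), mul_nonneg hC₂ (pow_nonneg hθ₂0 k)]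

end Three

end Summit.QuantumFields.BalabanUV.Beta.GAN24.BornLambdaDriftSup

end
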